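import Summits.CriticalPhenomena.PercolationContinuityZ3.Theorems.Transplant.KNCells2CorridorEdgeO
import Summits.CriticalPhenomena.PercolationContinuityZ3.Theorems.Transplant.KNCells2CorridorEdge
import Summits.CriticalPhenomena.PercolationContinuityZ3.Theorems.Transplant.KNCellsSchemeO
import Summits.CriticalPhenomena.PercolationContinuityZ3.Theorems.Transplant.KNCellsProcessO
import Summits.CriticalPhenomena.PercolationContinuityZ3.Theorems.Transplant.KNCells2SchemeO
import Summits.CriticalPhenomena.PercolationContinuityZ3.Theorems.Transplant.KNCellsStepsDefsO
import Summits.CriticalPhenomena.PercolationContinuityZ3.Theorems.Transplant.KNCellsStepsReachO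
import Summits.CriticalPhenomena.PercolationContinuityZ3.Theorems.Transplant.KNCellsStepsPinO
import Summits.CriticalPhenomena.PercolationContinuityZ3.Theorems.Transplant.KNCellsStepsSubboxO
import Summits.CriticalPhenomena.PercolationContinuityZ3.Theorems.Transplant.KNCells2CorridorO
import Summits.CriticalPhenomena.PercolationContinuityZ3.Theorems.Transplant.KNCells2RootChain
import Literature.Probability.Percolation.OrientedHistorySiteRenormalizationRun
import HarnessLib

/-!
# N2 (frames-only node `SamePDropOfSkeletonFrm₁`, OPEN) — ORIENTED MACRO LAYER (WAVE 0 (c1), (R-18) `q ≡ true`): the oriented twin of N1's `KNCells2RootChain`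

builds on p205010 (kernel theorem, internal audit signed; external expert review pending) — nothing in this file uses p205010; NOTHING is claimed about the
open node `SamePDropOfSkeletonFrm₁` (`SamePDropOfSkeletonNeg₁` is CLOSED in the tree and untouched by this file).
Status sentence (coordinator 2026-08-20T04:30Z): "θ(p_c) = 0 on ℤ^d, all d ≥ 2 — kernel-verified (Lean 4/Mathlib, standard axioms); internal adversarial
audit SIGNED 2026-08-20 04:29Z; external expert review pending."
Lane `prim-bschramm-*`, seat `prim-bschramm-stmt` (gen 19); helper file (`--supports stmt-CriticalPhenomena-4575 --as helper`); N2-SCOPE §20, (R-18)/(R-19).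
PORT RULES (HOME/prim-bschramm-stmt-g19/lean/port_orient.py): the history-site API is replaced by its ORIENTED twin at the fixed quadrant `qNE := fun _ => true`
(`HState.choice ↦ HState.ochoice qNE`, `mstOf ↦ omstOf qNE`, `mst/stN ↦ omst/ostN qNE`, `occFinal ↦ ooccFinal qNE`, `Lawful ↦ OLawful qNE`, onward directions
`onward ↦ onwardO` = the POSITIVE ones, (N2-e)); every declaration whose text changes thereby — directly or through a changed declaration — is re-declared with the
suffix `O` (same namespace); unchanged declarations of the N1 file are NOT repeated (the N1 module is imported). Docstrings/citations are N1's.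
N1 HEADER (kept for the reader):
* `W0root` — the root law restricted to the root world `U = Q_{a₀,0} ∪ E_{a₀,0,du}`;
* `W0sub U'`, **`hQ0_of_chain_sub`** — the same with the law restricted to a sub-world `U' ⊆ Q_0 ∪ E_{0,du}` containing the root (the
  fibre tube of the instance; restriction only lowers the inside-connection probability);
* **`hQ0_of_chain`** — a linked chain of target steps (any auxiliary graph `G'`, e.g. the tube graph) with common source `root`, kits under
  `W0root`, true targets inside enlarged ones with excess `≤ η ≤ δ/2`, a chain property at output accuracy `ε'' ≤ δc`, the source bound
  `1 - δ < P_{W0root}((s 0).reachB)` and the last true target inside `M_{a₀}(0 + du)` give the `du`-conjunct of `hQ0`.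
[cite: KozmaNitzan2024, §4 p. 27 (G₀), p. 28 ((32) at the root), Lemma 12 (pp. 23–25)]
-/
noncomputable section

open MeasureTheory ProbabilityTheory
open scoped ENNReal Classical

namespace Summit.CriticalPhenomena.PercolationContinuityZ3.Theorems

namespace Transplant

namespace KNCells

open Literature.Probability.Percolation Literature.Probability.LatticeModels SimpleGraph GadgetSystem ProbeHistory HSiteScheme Contour

variable {V : Type*} [DecidableEq V] [Countable V]

namespace KSchA

variable {A : Type*} (G : SimpleGraph V) [G.LocallyFinite] (S : KSchA V A)

variable {G S}

/-- **THE ROOT PROBE INPUT FROM A CHAIN** (design (D), D8). [cite: KozmaNitzan2024, §4 p. 28 ((32) at the root), Lemma 12] -/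
theorem hQ0_of_chainO (G' : SimpleGraph V) [G'.LocallyFinite] {du : MDir} {Δ' : ℕ} {δ ε'' η : ℝ} {n : ℕ} (hε : ε'' ≤ S.δc)
    (hchain : ∀ (W : Sym2 V → unitInterval) (s : Fin (n + 1) → KNLevels.TStep G') (T' : Fin (n + 1) → Finset V) (η : ℝ),
      (∀ i : Fin (n + 1), (s i).L.o = (s 0).L.o) →
      (∀ i : Fin n, T' (Fin.castSucc i) ⊆ (s i.succ).L.X 0) →
      (∀ i : Fin (n + 1), T' i ⊆ (s i).T) →
      (∀ i : Fin (n + 1), (s i).KitsAt W S.p Δ' δ) →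
      η ≤ δ / 2 →
      (∀ i : Fin (n + 1), (prodBernoulli W).real (⋃ t ∈ (s i).T \ T' i, openConn (s 0).L.o t) ≤ η) →
      1 - δ < (prodBernoulli W).real (s 0).L.reachB →
        1 - ε'' < (prodBernoulli W).real (⋃ t ∈ T' (Fin.last n), openConn (s 0).L.o t))
    (s : Fin (n + 1) → KNLevels.TStep G') (T' : Fin (n + 1) → Finset V) (ho : ∀ i : Fin (n + 1), (s i).L.o = S.Γ.root)
    (hlink : ∀ i : Fin n, T' (Fin.castSucc i) ⊆ (s i.succ).L.X 0) (hsub : ∀ i : Fin (n + 1), T' i ⊆ (s i).T)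
    (hkits : ∀ i : Fin (n + 1), (s i).KitsAt (S.W0root G du) S.p Δ' δ) (hη : η ≤ δ / 2)
    (hexc : ∀ i : Fin (n + 1), (prodBernoulli (S.W0root G du)).real (⋃ t ∈ (s i).T \ T' i, openConn S.Γ.root t) ≤ η)
    (hsrc : 1 - δ < (prodBernoulli (S.W0root G du)).real (s 0).L.reachB) (hroot : S.Γ.root ∈ S.U0root du)
    (hTn : T' (Fin.last n) ⊆ S.Γ.M S.Γ.a₀ ((0 : Site 2) + stepVec du)) : ((1 - S.δc < (prodBernoulli (pinW (KNLevels.lattW G S.p) ↑(S.U₀ G) ↑(S.U₀ G))).real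
      (⋃ t ∈ (↑(S.Γ.M S.Γ.a₀ ((0 : Site 2) + stepVec du)) : Set V),
        openConnIn (↑(S.Γ.Q S.Γ.a₀ 0 ∪ S.Γ.Ewv S.Γ.a₀ 0 du) : Set V) S.Γ.root t)) : Prop) := by
  have ho' : ∀ i : Fin (n + 1), (s i).L.o = (s 0).L.o := fun i => by rw [ho i, ho 0]
  have hexc' : ∀ i : Fin (n + 1), (prodBernoulli (S.W0root G du)).real (⋃ t ∈ (s i).T \ T' i, openConn (s 0).L.o t) ≤ η :=
    fun i => by rw [ho 0]; exact hexc i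
  have hc := hchain _ s T' η ho' hlink hsub hkits hη hexc' hsrc
  rw [ho 0, W0root, ← Finset.set_biUnion_coe, prodBernoulli_restrW_real_biUnion_openConn _ _ (Finset.mem_coe.2 hroot)] at hc
  have hc' : 1 - S.δc < (prodBernoulli (pinW (KNLevels.lattW G S.p) ↑(S.U₀ G) ↑(S.U₀ G))).real
      (⋃ t ∈ (↑(T' (Fin.last n)) : Set V), openConnIn (↑(S.U0root du) : Set V) S.Γ.root t) := by linarith
  refine hc'.trans_le (measureReal_mono ?_ (measure_ne_top _ _))
  rw [U0root]
  exact biUnion_openConnIn_mono subset_rfl _ (Finset.coe_subset.2 hTn)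

/-! ## The root law restricted to a sub-world (for the tube graph) -/

section Sub

variable (G S)

variable {G S}

/-- **THE ROOT PROBE INPUT FROM A CHAIN IN A SUB-WORLD** `U' ⊆ Q_{a₀,0} ∪ E_{a₀,0,du}` containing the root (restricting the world only lowers the
certified inside-connection probability). [cite: KozmaNitzan2024, §4 p. 28 ((32) at the root), Lemma 12] -/
theorem hQ0_of_chain_subO (G' : SimpleGraph V) [G'.LocallyFinite] {du : MDir} {U' : Finset V} (hU' : U' ⊆ S.U0root du) (hroot : S.Γ.root ∈ U')
    {Δ' : ℕ} {δ ε'' η : ℝ} {n : ℕ} (hε : ε'' ≤ S.δc)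
    (hchain : ∀ (W : Sym2 V → unitInterval) (s : Fin (n + 1) → KNLevels.TStep G') (T' : Fin (n + 1) → Finset V) (η : ℝ),
      (∀ i : Fin (n + 1), (s i).L.o = (s 0).L.o) →
      (∀ i : Fin n, T' (Fin.castSucc i) ⊆ (s i.succ).L.X 0) →
      (∀ i : Fin (n + 1), T' i ⊆ (s i).T) →
      (∀ i : Fin (n + 1), (s i).KitsAt W S.p Δ' δ) →
      η ≤ δ / 2 →
      (∀ i : Fin (n + 1), (prodBernoulli W).real (⋃ t ∈ (s i).T \ T' i, openConn (s 0).L.o t) ≤ η) →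
      1 - δ < (prodBernoulli W).real (s 0).L.reachB →
        1 - ε'' < (prodBernoulli W).real (⋃ t ∈ T' (Fin.last n), openConn (s 0).L.o t))
    (s : Fin (n + 1) → KNLevels.TStep G') (T' : Fin (n + 1) → Finset V) (ho : ∀ i : Fin (n + 1), (s i).L.o = S.Γ.root)
    (hlink : ∀ i : Fin n, T' (Fin.castSucc i) ⊆ (s i.succ).L.X 0) (hsub : ∀ i : Fin (n + 1), T' i ⊆ (s i).T)
    (hkits : ∀ i : Fin (n + 1), (s i).KitsAt (S.W0sub G U') S.p Δ' δ) (hη : η ≤ δ / 2)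
    (hexc : ∀ i : Fin (n + 1), (prodBernoulli (S.W0sub G U')).real (⋃ t ∈ (s i).T \ T' i, openConn S.Γ.root t) ≤ η)
    (hsrc : 1 - δ < (prodBernoulli (S.W0sub G U')).real (s 0).L.reachB)
    (hTn : T' (Fin.last n) ⊆ S.Γ.M S.Γ.a₀ ((0 : Site 2) + stepVec du)) : ((1 - S.δc < (prodBernoulli (pinW (KNLevels.lattW G S.p) ↑(S.U₀ G) ↑(S.U₀ G))).real
      (⋃ t ∈ (↑(S.Γ.M S.Γ.a₀ ((0 : Site 2) + stepVec du)) : Set V),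
        openConnIn (↑(S.Γ.Q S.Γ.a₀ 0 ∪ S.Γ.Ewv S.Γ.a₀ 0 du) : Set V) S.Γ.root t)) : Prop) := by
  have ho' : ∀ i : Fin (n + 1), (s i).L.o = (s 0).L.o := fun i => by rw [ho i, ho 0]
  have hexc' : ∀ i : Fin (n + 1), (prodBernoulli (S.W0sub G U')).real (⋃ t ∈ (s i).T \ T' i, openConn (s 0).L.o t) ≤ η :=
    fun i => by rw [ho 0]; exact hexc i
  have hc := hchain _ s T' η ho' hlink hsub hkits hη hexc' hsrc
  rw [ho 0, W0sub, ← Finset.set_biUnion_coe, prodBernoulli_restrW_real_biUnion_openConn _ _ (Finset.mem_coe.2 hroot)] at hc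
  have hc' : 1 - S.δc < (prodBernoulli (pinW (KNLevels.lattW G S.p) ↑(S.U₀ G) ↑(S.U₀ G))).real
      (⋃ t ∈ (↑(T' (Fin.last n)) : Set V), openConnIn (↑U' : Set V) S.Γ.root t) := by linarith
  refine hc'.trans_le (measureReal_mono ?_ (measure_ne_top _ _))
  have hU'' : (↑U' : Set V) ⊆ ↑(S.Γ.Q S.Γ.a₀ 0 ∪ S.Γ.Ewv S.Γ.a₀ 0 du) := by
    rw [← U0root]; exact Finset.coe_subset.2 hU'
  exact biUnion_openConnIn_mono hU'' _ (Finset.coe_subset.2 hTn)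

end Sub

end KSchA

end KNCells

end Transplant

end Summit.CriticalPhenomena.PercolationContinuityZ3.Theorems

end
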